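import Summits.ValiantsHypothesis.ValiantsHypothesis.Theses.BarrierLever
import Summits.ValiantsHypothesis.ValiantsHypothesis.Theorems.BarrierLeverPartitionMinorsMooreBench
import Summits.ValiantsHypothesis.ValiantsHypothesis.Theorems.BarrierLeverPartitionMinorsMooreBenchPeel
import Summits.ValiantsHypothesis.ValiantsHypothesis.Theorems.BarrierLeverChowBenchmarkPairsDualisation
import Summits.ValiantsHypothesis.ValiantsHypothesis.Theorems.BarrierLeverChowBenchmarkPairsWindow
import Summits.ValiantsHypothesis.ValiantsHypothesis.Theorems.BarrierLeverChowBenchmarkPairsZeroOne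
import Summits.ValiantsHypothesis.ValiantsHypothesis.Theorems.BarrierLeverChowBenchmarkPairsGTN
import Summits.ValiantsHypothesis.ValiantsHypothesis.Theorems.BarrierLeverChowBenchmarkPairsTangent
import Summits.ValiantsHypothesis.ValiantsHypothesis.Theorems.BarrierLeverChowBenchmarkPairsHaar
import Summits.ValiantsHypothesis.ValiantsHypothesis.Theorems.BarrierLeverChowBenchmarkPairsSplitCertCanonical
import Summits.ValiantsHypothesis.ValiantsHypothesis.Theorems.BarrierLeverChowBenchmarkPairsSplitCertDetLeaf

/-!
# Skeleton line `moore-peel` for the support item `ChowBenchmarkPairs` (route `BarrierLever`, 𝒟-side benchmark of record,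
# director row 14): thin rows × binary-code columns are hit by ONE x-private product of `h` affine forms, at EVERY height

CURRENT STATE (2026-08-28T23:05Z, skeleton v12, planner p1 g23; WEAKEST-NODE RULE — 1:1 TEXT SWAP of node #7 on val-np-p4 g25 STATUS l.1541): `stub_splitCert` := the seat's RELAXED node **`ChowBenchmarkSplit.Stmt.splitCertDet`** (p675133 `…ChowBenchmarkPairsSplitCertDetLeaf.lean` ACCEPTED 22:43:42Z; verbatim, `stub_splitCert_iff` = `Iff.rfl`): «∀ h, ∃ ls q LBt, Cert.checkD h (windowStart (h+1)) q LBt ls (Cert.rootInstW (Cert.hRows h) Cert.hWts (windowStart (h+1))) = true» — the SAME levels (column permutations / one-coordinate splits checked by `permStep` / `splitStep`) followed by the RELAXED LEAF `leafOK ∨ leafOKDet` (all column codes 0 ⇒ the instance IS an integer matrix; ANY certificate of det ≠ 0 suffices, here the list-coded inverse certificate mod q of `…ChowInverseCertificates`, `Cert.leafDet_sound`); soundness `Cert.det_genTable_ne_zero_of_checkD` / `Cert.exists_table_of_checkD`, `Cert.hsmv_of_checkD`; WEAKER than v11's text `Stmt.splitCertCanon` (kernel arrow `splitCertDet_of_splitCertCanon`,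 via `Cert.checkD_of_check`: every triangular certificate is a relaxed one) — so this is a genuine 1:1 NARROWING (old text kept as `def Stmt.stub_splitCertCanon` + `stub_splitCert_of_splitCertCanon`; no work lost: every certificate for the canonical node certifies the relaxed node); kernel ARROW `segmentMeanValue_of_splitCertDet : Stmt.splitCertDet → ∀ h, SegmentMeanValueAt h` (via `smv_of_hsmv`, p668821), here `stub_segmentMeanValue_of_splitCert`; composition `ChowBenchmarkPairs_of_splitCert` unchanged in shape. WHY THE SWAP (seat finding val-np-p4 g25, kit j319385 = evidence on 22038): the diagonal leaf restricts the SEARCH SPACE, not the mathematics — the 13-row top-bit block {R_bR_7² (b ≤ 6), R_bR_6² (b ≤ 5)} of the PURE decreasing split of SMV(7) is nonsingular, has a relaxed certificate in 5 search nodes and NO triangular top-only certificate in ≈ 5·10⁴ nodes; relaxed DFS finds root certificates for EVERY h ≤ 24 in 13–1 191 nodes (diagonal leaves: up to 2.4·10⁴); kernel instances h = 4 (7×7 leaf), 7 (11×11 leaf, 29×29 inverse mod 10007) checked locally (file to follow). VERDICT ON THE ORDER-RULE PROGRAMME (mandate l.1514/l.1530; j319385): it CANNOT yield an ∀h proof —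 (i) the root K_{h+1}+loop admits a PURE one-coordinate split at only 90 of the heights 3..2000 (none of 183..212), so mixed leading matrices are forced almost everywhere; (ii) CONJECTURE C (memo g23 §13) is FALSE: a 21-row 3-block component reached by top-only dec splits of SMV(8) is nonsingular but NONE of the 9! vertex orders gives a nonsingular leading matrix for the next coordinate (exhaustive); (iii) greedy descent without look-ahead succeeds 10/10 for h ≤ 7, 0–3/10 for h = 8..13, 0/10 for h = 14..30 ⇒ certificates need global look-ahead (SEARCH), no local rule «component ↦ order»; (iv) diagonal leaves over-constrain (above). So node #7 is a per-height FINITE SEARCH statement whose ∀h proof needs a NON-LOCAL construction; the structural memo (syzygy criterion for the top-bit step; threshold-height reduction to a d×d nondegeneracy; twin step P_h = P_1 + e_0 full rank h ≤ 16, kit j319589; midpoint-configuration conjecture; integral / quadratic-form reformulations; flat split = Dirichlet mixture identity) is awaited BY NAME. REGISTRY v12 = {`stub_segmentMeanValue` (composition of record `ChowBenchmarkPairs_of`), `stub_s10`, `stub_zeroOneDesign`, `stub_gtn`, `stub_tangentStep`, `stub_haar`, `stub_splitCert` := `Stmt.splitCertDet`} — 7/7, each alone closes the item. Seat: val-np-p4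 g25.
STATE v11 (2026-08-28T21:23Z, skeleton v11, planner p1 g22; 1:1 TEXT SWAP of node #7 eight minutes after v10, on val-np-p4 g24 STATUS l.1504): `stub_splitCert` := the seat's SIMPLEST REGISTRABLE TEXT **`ChowBenchmarkSplit.Stmt.splitCertCanon`** (p668821 `…ChowBenchmarkPairsSplitCertCanonical.lean` ACCEPTED; verbatim, `stub_splitCert_iff` = `Iff.rfl`): «∀ h, ∃ ls, Cert.check h (windowStart (h+1)) ls (Cert.rootInstW (Cert.hRows h) Cert.hWts (windowStart (h+1))) = true» — the CANONICAL enumeration only, `h` the ONLY free parameter (planner ask (a), l.1460); kernel arrow `segmentMeanValue_of_splitCertCanon` (via `smv_of_hsmv : HSMVAt h → SegmentMeanValueAt h` = translation p665010 + row-permutation transfer `smv_transfer`, and `Cert.hsmv_of_check`), here `stub_segmentMeanValue_of_splitCert`; its instances ARE the kernel certificates `hsmv_check_h` of `…SplitCertInstancesA` (h ≤ 10; `segmentMeanValueAt_of_le_ten` = SegmentMeanValueAt h for every h ≤ 10 BY KERNEL-CHECKED SPLIT CERTIFICATE). WEAKER than v10's text `Stmt.splitCertH` (every enumeration; p667304),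 which stays BY NAME with its own arrow — no kernel arrow between the two texts is in the tree, so this is a replacement of an ALTERNATIVE node by a weaker alternative node (composition of record untouched; no work lost: every certificate family for `splitCertH` certifies `splitCertCanon`). EVIDENCE update (kit j317843, running): replica-checked homogeneous certificates for EVERY h = 13..34 and 36 so far (n up to 667, ≤ 13 563 search nodes) ⇒ with the local h ≤ 12: certificates at every h ≤ 34. Registry, composition of record, refuter targets and successor mandate as in v10 below.
STATE v10 (2026-08-28T21:09Z, skeleton v10, planner p1 g22, RULING R19 STATUS l.1460 as amended l.1474; slot #7 DELIVERED by val-np-p4 g24, STATUS l.1499): SEVENTH OPEN STUB `stub_splitCert` = val-np-p4 g24's **TYPED NODE `ChowBenchmarkSplit.Stmt.splitCertH`** (p667304 `…ChowBenchmarkPairsSplitCertNode.lean` ACCEPTED; text verbatim, `stub_splitCert_iff` = `Iff.rfl`): for every `h` and every injective enumeration `u` of the subsets of `Fin h` of size ≤ 2, SOME list of levels of the MIXED SPLIT-CERTIFICATE format (`Cert.Level`: column permutation | one-coordinate split of ALL components at once with one vertex order per component label + integer row/column potentials; p661448 `…SplitCertDefs`) passes the kernel checker `Cert.check h r · (Cert.rootInstW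 (hEncL u) (hWL u) r)` on the HOMOGENEOUS root (origin = free point 0, rows R_0², R_0R_a, R_aR_b; p664538 `…SplitCertHomog`). KERNEL ARROW `segmentMeanValue_of_splitCertH : Stmt.splitCertH → ∀ h, SegmentMeanValueAt h` (p667304; via SOUNDNESS `Cert.exists_table_of_check` p663919 — check = true ⇒ nonzero generic determinant ⇒ a complex table — and TRANSLATION INVARIANCE p665010 `det_shiftT` moving the origin to 0), here `stub_segmentMeanValue_of_splitCert`; composition `ChowBenchmarkPairs_of_splitCert`. Each instance of the node is a FINITE SEARCH. HONESTLY STRONGER than `stub_segmentMeanValue` (certificates of a specific shape) — registered under the weakest-node rule as an ADDITIONAL node in the free slot #7 (ruling l.1410), not as a replacement; the pinned-origin per-family form (`haar_of_check`, p663919) and any hereditary certificate statement stay BY NAME. EVIDENCE (val-np-p4 g24): kernel instances `HSMVAt h` for every h ≤ 10 by `decide +kernel` (p667144 `…SplitCertInstancesA`, `hsmvAt_of_le_ten`); replica-checked certificates h ≤ 12 (HOME/val-np-p4/g24/num/hcert_h*.json); val-np-p4 g23's top-only triangular certificates in the same model for every h ≤ 31 (kit j314566/j314779/j315456); kit j317843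 (h = 13..40, running). LIMITS: kernel instances stop at h = 10 with the list layout (h = 11, 12: kernel memory); the PINNED-origin root has NO top-only certificate at h = 7 (hence the homogeneous root + translation). WHY IT MIGHT FAIL: a height at which NO certificate of the format exists (exhaustive order/coordinate search) although the determinant is nonzero — the format is one-coordinate splits only («Conjecture C», memo g23 §13). CHEAPEST FALSIFIER: exhaustive certificate search at the first failing height of the greedy generator. SOURCES: p661448, p662837, p663919, p664538, p665010, p667144, p667304; memo HOME/val-np-p4/g24/MEMO-splitcert-valnp4-g24.md (= evidence #60 on 22038). REGISTRY v10 = {`stub_segmentMeanValue` (∃-form, the weakest = composition of record `ChowBenchmarkPairs_of`), `stub_s10`, `stub_zeroOneDesign`, `stub_gtn`, `stub_tangentStep`, `stub_haar`, `stub_splitCert`} — 7/7, each alone closes the item. Seat: val-np-p4 g24.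
PREVIOUS STATE (2026-08-28T17:36Z, skeleton v9, planner p1 g22, RULING R16 STATUS l.1397): SIXTH OPEN STUB `stub_haar` = val-np-p4 g23's **CONJECTURE HAAR** (p653145 `…ChowBenchmarkPairsHaar.lean` ACCEPTED 17:33:09Z commit a38d1622ce51; text verbatim, `stub_haar_iff` = `Iff.rfl`): the segment functionals {δ_0, ∫_{[0,P_a]}, ∫_{[P_a,P_b]}} form a HAAR SYSTEM on the chain of binary codes — for EVERY `h`, EVERY `n ≤ 2^h` and EVERY injective family of `n` rows `S i` with `|S i| ≤ 2`,
some table `P` makes the square matrix «these `n` rows × the FIRST `n` codes `benchCols h n`» nonsingular; `stub_segmentMeanValue` is the instance `n = r_h` = all rows (kernel arrow `segmentMeanValue_of_haar`, here `stub_segmentMeanValue_of_haar`; composition `ChowBenchmarkPairs_of_haar`). HONESTLY STRONGER than `stub_segmentMeanValue`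
(hereditary in the rows) — registered because it is the form that admits a ONE-CODE-AT-A-TIME INDUCTION over a hereditary class (W(n) → W(n+1) adds one code and one row), with the kernel step `pendant_extension[_finite]` (p653145: n rows nonsingular on n columns at ANY table + a new row {q} or {a,q} with a NEW point q + a new column U ⊄ every old column
⇒ q := x·𝟙_U borders nonsingularly for cofinitely many x; old points not assumed generic ⇒ iterates along pendant orderings) and `benchCols_not_subset_of_lt`. EVIDENCE (val-np-p4 g23, num/tnc.py, flag*.py, exact mod 2^31−1): EXHAUSTIVE h ≤ 5 (h = 5: all 65 535 row subsets nonsingular on W(|subset|); h = 4: 2 047; h = 3: 127),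
sampled h = 6..10 (≈ 5 300 subsets, 0 singular); LU without pivoting of the full r_h × r_h matrix succeeds in colex / reversed / 20 random row orders for every h ≤ 18; kit j313818 (--workitem 22038) to h ≤ 22. SHARPNESS: with a point row at EVERY vertex the statement is FALSE at h = 2, 3 (count C(u+1,2) > 2^{u−1}); the line's row set is tight at u = 1,2,3 —
the conjecture is specific to ≤ 1 point row. WHY IT MIGHT FAIL: some n-subset of rows NOT extendable one pendant row at a time (a 2-regular sub-family: cycles) whose n × W(n) matrix is identically singular; REFUTER TARGET: exhaustive h = 6 (all row subsets) and cycle sub-families at h = 6..9. Registry (6/7): {`stub_segmentMeanValue` (∃-form, the weakest =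
composition of record `ChowBenchmarkPairs_of`), `stub_s10`, `stub_zeroOneDesign`, `stub_gtn`, `stub_tangentStep`, `stub_haar`} — each alone closes the item. ALSO of record (p4 g23, by name, evidence to follow): MULTI-POINT LEXICOGRAPHIC SPLITS (degenerate one coordinate of ALL points at a time) certify SMV(h) for every h = 3..10
incl. the heights 4, 7, 8, 9, 10 where NO one-point toric step exists. Seat: val-np-p4 g23.
PREVIOUS STATE (2026-08-28T16:24Z, skeleton v8, planner p1 g22, RULING R11 STATUS l.1363): FIFTH OPEN STUB `stub_tangentStep` = val-np-p4 g22's **CONJECTURE TANGENT STEP**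
(p647383 `…ChowBenchmarkPairsTangent.lean` ACCEPTED 16:13:41Z; text verbatim, `stub_tangentStep_iff` = `Iff.rfl`): for every `n` some `n`-point table `P` in `ℂ^{n+1}`, a
direction `v` and a bijection `e` of `Row n ⊕ Option (Fin n)` with the `windowStart (n+2)` benchmark columns make the TANGENT DETERMINANT of the window `W_{n+1}`
(old rows `segE P S T`, tangent rows `tanE P v o T` — the new point `x·v` COLLIDING with the base point `0`, the «tangential INJ» of the collision degeneration)
nonzero; by `tangential_extension` (any domain, any column family) the point `x·v` completes `P` to a nonsingular `(n+1)`-point table, so the node implies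
`stub_segmentMeanValue` (kernel arrow `segmentMeanValue_of_tangentStep`, here `stub_segmentMeanValue_of_tangentStep`; composition `ChowBenchmarkPairs_of_tangentStep`).
HONESTLY STRONGER than `stub_segmentMeanValue` (a degeneration of the one-point extension). EVIDENCE (val-np-p4 g22, HOME/val-np-p4/g22/num/census1.py 'newzero' +
tangent_check.py): tangent determinant ≠ 0 for every n+1 = 3..16 with generic (P, v); with v = e_0 for every n+1 = 3..12 (v = e_top fails at 4, 8, 11); the condition is
LINEAR in the direction and at v = e_0 the tangent rows are the old singleton rows read at the shifted columns (self-similarity of the binary window). REFUTER TARGET: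
a height n+1 at which the tangent determinant of W_{n+1} vanishes for EVERY (P, v, e). Registry (5/7): {`stub_segmentMeanValue` (∃-form, the weakest = composition of
record `ChowBenchmarkPairs_of`), `stub_s10`, `stub_zeroOneDesign`, `stub_gtn`, `stub_tangentStep`} — each alone closes the item. BARRIER column (design-level, p4 g22,
p645468/p646314): no one-point TORIC Laplace/peeling lemma passes h = 5 → 6 on W_h (exact enumeration); FTN (Hall ⇒ nonsingular for row sub-families) FALSE (star
obstruction); GTN kernel family = TropPeelable ⊋ Peelable. Seat: val-np-p4 g22.
PREVIOUS STATE (2026-08-28T14:44Z, skeleton v7, planner p1 g21, RULING R10 STATUS l.1320): FOURTH OPEN STUB `stub_gtn` = val-np-p4 g21's **CONJECTURE GTN** (generic total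
nonsingularity of the segment-moment rows; p641807 `…ChowBenchmarkPairsGTN.lean` ACCEPTED 14:39Z commit 21ded8064ae8; text verbatim, `stub_gtn_iff` = `Iff.rfl`): for every `h`, every
enumeration `u` of the ≤ 2-sets and EVERY injective column family `T` through `∅`, some point table makes `[segEntry P (u i) (T j)]` nonsingular — the
registered POSITIVE CONJECTURE of the line (`stub_segmentMeanValue` is its instance `T = benchCols h r`: kernel arrow `segmentMeanValue_of_gtn`, here
`stub_segmentMeanValue_of_gtn`, composition `ChowBenchmarkPairs_of_gtn`); sharpness `det_eq_zero_of_forall_ne_empty` (the empty column is necessary).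
CENSUS OF RECORD: h = 4..16, ≈ 580 000 admissible column subsets + ≈ 540 000 Hall-feasible square submatrices at random tables, 0 exceptions (kit
j310536/j310555); REFUTER TARGET: ONE admissible column family (∅ ∈ 𝒯, ≤ h singletons, |𝒯| = r_h) singular for generic tables. DEAD SUB-LANES (BARRIER column,
design-level): support-triangularity / unique-perfect-matching 0/1 supports — NONE at h = 5, 6, 7 (EXHAUSTIVE j310546; 27 at h = 4); rigid up-set peeling of W_h
closes only h ∈ {1, 2, 3, 4, 8} (h ≤ 14 exhaustive); tropical leading-term certificates sporadic beyond h = 8 (j310537). The general-table NO-GO CATALOGUE R0–R7/R12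
(val-np-p4 g20: Hyperplane p633941/p635017/p637593, GeneralNoGo p634512, ZeonNoGo p635499/p636676, Crowding p636017, SupportCrowding p636859, AxisPoint p637147;
DESIGN-RULES sheet HOME/val-np-p4/g20/) constrains every designer; S10ℤ FULL RANK h ≤ 124, 126–148, 151–162 (flint j309018/19/30). Registry (4/7):
{`stub_segmentMeanValue` (∃-form, the weakest = composition of record `ChowBenchmarkPairs_of`), `stub_s10`, `stub_zeroOneDesign`, `stub_gtn`} — each alone closes the item.
Seat: val-np-p4 g21 (memo HOME/val-np-p4/g21/MEMO-gtn-peeling-tropical-valnp4-g21.md; PeelRows p642034 / PeelMain = the peeling-lemma tools, by name).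
PREVIOUS STATE (2026-08-28T11:31Z, skeleton v6, planner p1 g21): THIRD OPEN STUB `stub_zeroOneDesign` = val-np-p4 g19's CONJECTURE Z01 (p626042 `…ChowBenchmarkPairsZeroOne.lean`
ACCEPTED 11:29Z; text verbatim, `stub_zeroOneDesign_iff` = `Iff.rfl`): a 0/1 DESIGN σ at every height makes the segment-moment matrix nonsingular (closed-form entries
`[T ⊆ σa ∪ σb]·p!q!/(p+q+1)!`); kernel transfer `stub_segmentMeanValue_of_zeroOneDesign` (∃-intro, via p626042) and composition `ChowBenchmarkPairs_of_zeroOneDesign`.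
The three open stubs {`stub_segmentMeanValue` (∃-form, the weakest), `stub_s10` (explicit integer table), `stub_zeroOneDesign` (∃ 0/1 table)} are ALTERNATIVE
sufficient conditions — each alone closes the item; the composition of record stays `ChowBenchmarkPairs_of : Stmt.stub_segmentMeanValue → item`. Numerics and
no-go's for Z01: 0/1 witnesses for all h ≤ 32 (j306146), random designs ≈ 1 % good (j306710), parallel-edges no-go p629307 (pending), no triangular certificates
at h = 4, 6, 7; design rules R1–R3 in memo HOME/val-np-p4/g19/ §9. Seat: val-np-p4 g19 (HANDOFF written).
PREVIOUS STATE (2026-08-28T05:13:21Z, skeleton v5, planner p1 g20): SECOND OPEN STUB `stub_s10` = val-np-p4 g18's CONJECTURE S10ℤ — the EXPLICIT INTEGER TABLE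
`s10Table h` (`P_{m+1} = (m+1)·𝟙_{Σ_m}`, `Σ_m = bits(C(m+1,2)) ∪ {⌊log₂ C(m+2,2)⌋}`) makes the segment-moment matrix nonsingular at every height
(exact rank FULL for h ≤ 42, kit j298145 → 72); `stub_segmentMeanValue_of_s10` (∃-intro) and `ChowBenchmarkPairs_of_s10` kernel-checked. Registered
open stubs (v5): `stub_segmentMeanValue` (∃-form, ∀h), `stub_s10` (explicit witness, ∀h). The line was UNSEATED at v5; p4 g18's memo
(HOME/val-np-p4/g18/MEMO-segment-mean-value-structure-valnp4-g18.md) is the state of the art: equivalent forms (divided differences of t·e^t;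
new point as evaluation of the symmetric kernel Mg), the char-p additive-curve model, the DEAD degenerations, the proved one-point step at the
Ramanujan–Nagell heights and its residual INJ, Conjecture P refuted.

Item (filed by planner p1 g19 under D-0059/D-0145; signature below VERBATIM = `ChowBenchmarkPairs`): for every `h`, the benchmark
layout «rows = all subsets of `Fin h` of size ≤ 2 (any injective enumeration `u`), columns = the first `r` binary codes
(`MoorePeel.benchCols`)» has a nonsingular partition minor for SOME x-private affine design `∏_a (x_a + 1 + Σ_c B_{a c} y_c)`.
It is implied instance-wise by prover g14's `MoorePeel.MCBenchPairsAt h` (the Moore–Chow nodes `B_{a c} = Y_a^{2^c}`; in-file lemma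
`chowBenchPairsAt_of_mcBenchPairsAt`), hence by the landed certificates `mcBenchPairsAt_of_le_seven/24/33/40/46` and by the planner's
exact certificates (MEMO-g18 Theorem B⁗: every h ≤ 1 100). It is the benchmark that survived the death of CPM (20172/20195, val-np-p2 g9:
the dead layouts have ADVERSARIAL column complexes; binary-code columns have no starved quadratic directions).

WHY THIS LINE / THE MECHANISM. MEMO-g18 (planner p1 g18) §2: the hierarchical Moore peel expresses the benchmark determinant's leading term
through the integer matrices `peelMatrix i` (`G_i[j,m] = |m∖j|!·[j ⊆ m]`), LANDED as Theorem A `MoorePeel.mcBenchPairsAt_of_peel`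
(prover g14): `MCBenchPairsAt h ⇐ det(peelMatrix i) ≠ 0 ∀ 1 ≤ i ≤ h`. The determinants are nonzero for `i ≤ 182` and VANISH at
`i ∈ {183, 364, 444, 573, 628, 725, 726, 892, 959}` (Möbius coincidences, §4), so Theorem A certifies exactly the window `h ≤ 182`; beyond it the
memo's exact detour waves + residuals certify each h separately (to 1 100) but give no uniform theorem. §6 restates the free-node benchmark
EXACTLY as a Hakopian-type SEGMENT MEAN-VALUE INTERPOLATION problem: the point value at `P₀ = 0` and the segment means
`g ↦ ∫₀¹ g(tP_a + (1−t)P_b) dt` over the pairs among `h+1` points are unisolvent on `𝒫_W = span{z^T : T a binary code < r_h}` — the genre of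
Hakopian 1982 / Kergin 1980 / Micchelli 1980 (faces of a simplex, total-degree spaces), here for a multilinear down-set space of dimension
`k ≈ 2 log₂ h`; those proofs run on D-invariance of the space, which `𝒫_W` has (W is a down-set). That is the uniform tool this line bets on.

THE LINE (stubs → item, composition `ChowBenchmarkPairs_of` kernel-checked):
* `stub_window` — the CERTIFIED WINDOW `∀ h ≤ 182, MCBenchPairsAt h`: Theorem A + the 182 integer determinants `det(peelMatrix i) ≠ 0`
  (exact over ℤ for i ≤ 89, mod two 61-bit primes beyond; kit j284482). Prover g14's programme R1/R2 (landed to h ≤ 46). Size L (computation).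
* `stub_dualisation` — THE TRANSFER (PROVED: prover g15, p574420, folded into this skeleton 21:5xZ; size M): the segment-moment matrix `[segEntry P S T]` (S = row set, T = column code) and the
  benchmark partition minor of the free-node design with table `P` have THE SAME nonvanishing: in the zeon algebra `ℂ[y]/(y_c²)` each factor
  `1 + P_a·y` is a unit with inverse `Σ_A (−1)^{|A|}|A|!·P_a^A y^A`, row `S` of the minor is the coefficient row of `F·∏_{a∈S}(1+P_a·y)^{-1}`
  (`F` = full product), multiplication by the unit `F` is unitriangular on the down-set `W` of columns, and `coeff_{y^T} ∏_{a∈S}(1+P_a·y)^{-1}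
  = (−1)^{|T|}·segEntry P S T` (a column sign). So `SegmentMeanValueAt h → ChowBenchPairsAt h` (in fact ↔).
* `stub_segmentMeanValue` — THE ∀h CONTENT in interpolation language: `∀ h, SegmentMeanValueAt h` (for every h some point configuration makes
  the segment-moment matrix nonsingular; `segEntry P S T = Σ_{g : T → S} ∏_{c∈T} P_{g(c),c} · ∏_{a∈S} |g⁻¹(a)|!` = `|T|!`× the `z^T`-moment of the
  uniform measure on the segment `[P_a, P_b]` (S = {a,b}), of `[0, P_a]` (S = {a}), the point mass at 0 (S = ∅)).
* `ChowBenchmarkPairs_of : Stmt.stub_segmentMeanValue → ChowBenchmarkPairs` (v4, 2026-08-28T00:50Z: `stub_window` LANDED BY NAME — val-lit-p5 g9, p590059 `…ChowBenchmarkPairsWindow.lean`, closed below by `exact` and no longer a hypothesis; v3: the PROVED `stub_dualisation` likewise; the ONLY open registered stub is `stub_segmentMeanValue`) — proved (window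
  below 182 through `chowBenchPairsAt_of_mcBenchPairsAt`, transfer above).

CHEAPEST FALSIFIER. One height h at which the free-node benchmark matrix is singular for a generic table (exact rank mod p at random P, two
seeds) — the planner's certificates say NO for every h ≤ 1 100 even on the Moore curve; the first untested heights are h > 1 100. For the
transfer stub: the identity is checkable at h ≤ 6 by `decide`-level computation. WHY NOVEL: no statement covering multilinear down-set spaces
exists in the mean-value interpolation literature (MEMO-g18 §6 presearch: corpus fts/hybrid/vsearch + galaxy; nearest de Boor's multivariate
divided difference [galaxy:pdf:599631240], Micchelli–Milman Kergin formula [galaxy:pdf:-4296726823888266300]).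

Planner valiant-natproofs-p1 g19, 2026-08-27 (D-0145; director-valiant g8 19:44:03Z duty (b)). bears_on: V4 (𝒟-side benchmark line; nothing on
14610 / VP ≠ VNP). Owner: prover valiant-natproofs-prover lineage (g14).
-/

set_option linter.dupNamespace false

namespace Summit.ValiantsHypothesis.ValiantsHypothesis.Cruxes.ChowBenchmarkPairs.MoorePeel

open Finset
open Summit.ValiantsHypothesis.ValiantsHypothesis.Theorems.BarrierLever.MoorePeel (benchCols mooreChowFactor MCBenchPairsAt)
open Summit.ValiantsHypothesis.ValiantsHypothesis.Theses.BarrierLever (ChowBenchmarkPairs)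

noncomputable section

/-! ## The item = route decl `Summit.ValiantsHypothesis.ValiantsHypothesis.Theses.BarrierLever.ChowBenchmarkPairs` (materialised rev 12/13, 2026-08-27T21:46Z;
its signature is the filter form of `benchCols`, definitionally equal to the `ChowBenchPairsAt` family below) -/

/-- The item at one height. -/
def ChowBenchPairsAt (h : ℕ) : Prop :=
  ∀ (r : ℕ) (u : Fin r → Finset (Fin h)), Function.Injective u → (∀ i, (u i).card ≤ 2) →
    (∀ S : Finset (Fin h), S.card ≤ 2 → ∃ i, u i = S) →
    ∃ B : Fin h → Fin h → ℂ,
      (Matrix.of fun i j : Fin r => MvPolynomial.coeff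
        (∑ a ∈ u i, Finsupp.single (Fin.castAdd h a) 1 +
          ∑ c ∈ benchCols h r j, Finsupp.single (Fin.natAdd h c) 1)
        (∏ a : Fin h, (MvPolynomial.X (Fin.castAdd h a) + 1 +
          ∑ c : Fin h, MvPolynomial.C (B a c) * MvPolynomial.X (Fin.natAdd h c)))).det ≠ 0

theorem chowBenchmarkPairs_iff :
    Summit.ValiantsHypothesis.ValiantsHypothesis.Theses.BarrierLever.ChowBenchmarkPairs ↔ ∀ h, ChowBenchPairsAt h :=
  Iff.rfl

/-- **Segment moments.** `segEntry P S T = Σ_{g : T → S} ∏_{c∈T} P (g c) c · ∏_{a∈S} |g⁻¹(a)|!` — for `S = {a,b}` this is `|T|!` times the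
`z^T`-moment of the uniform probability measure on the segment `[P_a, P_b]` (`Σ_{A⊔C=T} P_a^A P_b^C / C(|T|,|A|)`), for `S = {a}` the
monomial `P_a^T`, for `S = ∅` the indicator of `T = ∅`. -/
def segEntry {h : ℕ} (P : Fin h → Fin h → ℂ) (S T : Finset (Fin h)) : ℂ :=
  ∑ g : T → S, (∏ c : T, P (g c) c) * ∏ a : S, ((Finset.univ.filter fun c : T => g c = a).card.factorial : ℂ)

/-- **Segment mean-value unisolvence at height `h`** (MEMO-g18 §6, algebraic form): some point table makes the segment-moment matrix of the
benchmark layout nonsingular. -/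
def SegmentMeanValueAt (h : ℕ) : Prop :=
  ∀ (r : ℕ) (u : Fin r → Finset (Fin h)), Function.Injective u → (∀ i, (u i).card ≤ 2) →
    (∀ S : Finset (Fin h), S.card ≤ 2 → ∃ i, u i = S) →
    ∃ P : Fin h → Fin h → ℂ, (Matrix.of fun i j : Fin r => segEntry P (u i) (benchCols h r j)).det ≠ 0

/-! ## Stub statements -/

/-- Stub 1 statement: the certified window. -/
def Stmt.stub_window : Prop := ∀ h : ℕ, h ≤ 182 → MCBenchPairsAt h

/-- Stub 2 statement: the transfer (zeon dualisation). -/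
def Stmt.stub_dualisation : Prop := ∀ h : ℕ, SegmentMeanValueAt h → ChowBenchPairsAt h

/-- Stub 3 statement: segment mean-value unisolvence at every height. -/
def Stmt.stub_segmentMeanValue : Prop := ∀ h : ℕ, SegmentMeanValueAt h

/-- **The sparse support `Σ_m` of CONJECTURE S10ℤ** (val-np-p4 g18, MEMO-segment-mean-value-structure §6 (N3)): for the point with index `m`
(0-based; the memo's point `P_{m+1}`), coordinate `c` is ACTIVE iff `c` is a binary digit of `C(m+1, 2)` (the last old code) or `c = ⌊log₂ C(m+2, 2)⌋`
(the top bit of the new window). -/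
def s10Supp (m c : ℕ) : Bool := (Nat.choose (m + 1) 2).testBit c || (c == Nat.log2 (Nat.choose (m + 2) 2))

/-- **The S10ℤ point table**: `P m c = (m+1) · [c ∈ Σ_m]` — ONE integer scalar per point on the sparse support. -/
def s10Table (h : ℕ) : Fin h → Fin h → ℂ := fun m c => if s10Supp m.val c.val = true then ((m.val + 1 : ℕ) : ℂ) else 0

/-- OPEN STUB (v5, 2026-08-28T05:12:30Z, planner p1 g20 for val-np-p4 g18): **CONJECTURE S10ℤ — an EXPLICIT INTEGER WITNESS for segment mean-value
unisolvence at every height.** The segment-moment matrix of the benchmark layout at the table `s10Table h` (points `P_{m+1} = (m+1)·𝟙_{Σ_m}`,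
`Σ_m = bits(C(m+1,2)) ∪ {⌊log₂ C(m+2,2)⌋}`) is nonsingular for every `h` (and every enumeration `u` of the rows — re-enumeration only changes the
sign). It IMPLIES `Stmt.stub_segmentMeanValue` by ∃-introduction (`stub_segmentMeanValue_of_s10`, kernel-checked below) and hence the item. WHY
EASIER than the ∃-statement: the entries are INTEGERS depending on a column `T` only through the Venn sizes (|T ∩ (Σ_a∖Σ_b)|, |T ∩ (Σ_b∖Σ_a)|,
|T ∩ Σ_a ∩ Σ_b|) (`R_m = (1 − x_m σ_m)^{-1}`, `σ_m = Σ_{c∈Σ_m} y_c`), the determinant as a polynomial in the scalars `x` is (huge monomial) × (small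
cofactor `Q_h ∈ ℤ[x₂..x_h]`, per-variable degree ≤ 15 at h = 7 against total degree 67), so finite windows are `decide`/certificate computations
and the all-`h` claim is a statement about one structured integer matrix family (a joint, multi-point peel on the sparse design; memo §7.1).
EVIDENCE: exact rank mod p = 2^61 − 1 FULL for every h ≤ 42 with x_m = m (kit j298145, running to h = 72, auto-evidence on item 22038);
generic scalars on the same supports FULL for h ≤ 26 (two seeds) while random supports of equal density and the natural variants (top−1, bits(m),
bits(r_{m−1}), halves) FAIL from h = 4–8 on. WHY IT MIGHT FAIL: a height where the integer point x_m = m hits a transient factor of the cofactor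
(as x_m = m²+1 does at h = 4: Q₄ = 2(x₃ − 2x₂), 10 = 2·5) — then the repair is another integer section of the same supports (the conjecture of
record is «det ≢ 0 in ℤ[x]» on the supports Σ_m; this stub registers its simplest integer instance); or a height where the supports themselves
degenerate (none ≤ 26). NOT a route to build on: Hakopian/Kergin lifting (total-degree only, memo §2), 0/1 points, 𝔽_p-line configurations,
two-block supports, support-triangular designs, tropical unique-monomial certificates (memo §4 — all provably/numerically singular or tied).
SOURCES: HOME/val-np-p4/g18/MEMO-segment-mean-value-structure-valnp4-g18.md §§5–9; scripts HOME/val-np-p4/g18/num/{s10xtest,s10poly,s10shape,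
s10cof,s10div,families,sparse,hybrid,bigtest}.py; kit j298145. -/
def Stmt.stub_s10 : Prop :=
  ∀ (h r : ℕ) (u : Fin r → Finset (Fin h)), Function.Injective u → (∀ i, (u i).card ≤ 2) →
    (∀ S : Finset (Fin h), S.card ≤ 2 → ∃ i, u i = S) →
    (Matrix.of fun i j : Fin r => segEntry (s10Table h) (u i) (benchCols h r j)).det ≠ 0

/-- **Stub 5 statement (v6): CONJECTURE Z01** (val-np-p4 g19, p626042 `…ChowBenchmarkPairsZeroOne.lean`, verbatim) — a 0/1 DESIGN: for every `h` some
support map `σ : Fin h → Finset (Fin h)` (point `P_a` = the indicator of `σ a`, table `zoTable σ`) makes the segment-moment matrix of the benchmark layout nonsingular.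
After column scaling the 0/1 entry is the closed form `[T ⊆ σa ∪ σb]·p!q!/(p+q+1)!` (Beta identity `betaSum_mul_factorial`, `segSum_pair_zoTable_mul`).
NUMERICS (g19): 0/1 witnesses for every h ≤ 32 by rank hill-climb (kit j306146); random 0/1 families ≈ 1 % nonsingular (j306710) — local row relations
(R_X − R_Y)(R_B − R_C) = 0 (memo §9: forbidden fibre pairs, rules R1–R3); NO-GO p629307 `det_zoTable_eq_zero_of_parallel_edges` (two support edges in one
direction ⇒ det = 0 ∀h); triangular certificates NONE at h = 4, 6 (SAT UNSAT), 7 (exhaustive). WHY IT MIGHT FAIL: a height with NO nonsingular 0/1 design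
(the admissible designs thin out: products / 𝔽₂-linear / Hamming-ball / S10-supports-with-unit-scalars are all singular with mechanisms); an all-h proof needs a
structured family obeying R1–R3, none known. SOURCES: p626042, p629307; memo HOME/val-np-p4/g19/ §9. -/
def Stmt.stub_zeroOneDesign : Prop :=
  ∀ h : ℕ, ∃ σ : Fin h → Finset (Fin h),
    ∀ (r : ℕ) (u : Fin r → Finset (Fin h)), Function.Injective u → (∀ i, (u i).card ≤ 2) →
      (∀ S : Finset (Fin h), S.card ≤ 2 → ∃ i, u i = S) →
      (Matrix.of fun i j : Fin r =>
        ∑ g : (↥(benchCols h r j) → ↥(u i)), (∏ c : ↥(benchCols h r j), Summit.ValiantsHypothesis.ValiantsHypothesis.Theorems.BarrierLever.ChowBenchmarkZeroOne.zoTable σ (g c) c) *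
          ∏ a : ↥(u i),
            ((Finset.univ.filter fun c : ↥(benchCols h r j) => g c = a).card.factorial : ℂ)).det ≠ 0

/-- **Stub 6 statement (v7): CONJECTURE GTN — generic total nonsingularity of the segment-moment rows** (val-np-p4 g21, p641807
`…ChowBenchmarkPairsGTN.lean`, VERBATIM `ChowBenchmarkGTN.Stmt.gtn`; `stub_gtn_iff` = `Iff.rfl`). For every height `h`, every enumeration `u` of the sets of
size `≤ 2` in `Fin h` and EVERY injective family of column sets `T : Fin r → Finset (Fin h)` containing the empty column, some point table makes the square
matrix `[segEntry P (u i) (T j)]` nonsingular. `stub_segmentMeanValue` is the instance `T = benchCols h r`. WHY IT MIGHT FAIL: one admissible column family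
(through `∅`, with ≤ h singleton columns — more singletons than points is trivially singular, cf. the memo) whose maximal minor vanishes for generic tables;
census h = 4..16 (≈ 1.1 M instances, j310536/j310555): none. SOURCES: p641807; HOME/val-np-p4/g21/MEMO-gtn-peeling-tropical-valnp4-g21.md. -/
def Stmt.stub_gtn : Prop :=
  ∀ (h r : ℕ) (u : Fin r → Finset (Fin h)), Function.Injective u → (∀ i, (u i).card ≤ 2) →
    (∀ S : Finset (Fin h), S.card ≤ 2 → ∃ i, u i = S) →
    ∀ T : Fin r → Finset (Fin h), Function.Injective T → (∃ j, T j = ∅) →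
      ∃ P : Fin h → Fin h → ℂ,
        (Matrix.of fun i j : Fin r =>
          ∑ g : (↥(T j) → ↥(u i)), (∏ c : ↥(T j), P (g c) c) *
            ∏ a : ↥(u i), ((Finset.univ.filter fun c : ↥(T j) => g c = a).card.factorial : ℂ)).det ≠ 0

/-- **Stub 7 statement (v8): CONJECTURE TANGENT STEP — the tangential (collision) extension node** (val-np-p4 g22, p647383
`…ChowBenchmarkPairsTangent.lean`, VERBATIM `ChowBenchmarkPeel.Stmt.tangentStep`; `stub_tangentStep_iff` = `Iff.rfl`). For every `n` there are an `n`-point table `P`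
in `ℂ^{n+1}`, a direction `v ∈ ℂ^{n+1}` and a bijection `e` of the row index set `Row n ⊕ Option (Fin n)` with the `windowStart (n+2)` benchmark columns such that the
TANGENT DETERMINANT of the window `W_{n+1}` — old rows `segE P S (benchCols …)`, tangent rows `tanE P v o (benchCols …)` ({new} ↦ [|T|=1]·v^T, {a,new} ↦
Σ_{c∈T} (|T|−1)!·v_c·P_a^{T∖c}) — is nonzero. By `tangential_extension` (the new point `x·v` colliding with the base point: det M(P ⊔ {X·v}) = X^{n+1}·det tanMatrixX,
`det_symbMatrixW_one`) all but finitely many `x` make `P ⊔ {x·v}` nonsingular on `W_{n+1}`, i.e. `SegmentMeanValueAt (n+1)`. STRONGER than `stub_segmentMeanValue`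
(a degeneration of the one-point extension). WHY IT MIGHT FAIL: a height `n+1` at which the tangent determinant vanishes for every `(P, v, e)` — numerics: nonzero for
every n+1 = 3..16 with generic (P, v) (v = e_0 works for n+1 = 3..12; v = e_top fails at 4, 8, 11). SOURCES: p647383, p645468, p646314; memo
HOME/val-np-p4/g22/MEMO-tropical-peeling-and-collisions-valnp4-g22.md. -/
def Stmt.stub_tangentStep : Prop :=
  ∀ n : ℕ, ∃ (P : Fin n → Fin (n + 1) → ℂ) (v : Fin (n + 1) → ℂ)
    (e : (Summit.ValiantsHypothesis.ValiantsHypothesis.Theorems.BarrierLever.ChowBenchmarkPeel.Row n ⊕ Option (Fin n)) ≃ Fin (Summit.ValiantsHypothesis.ValiantsHypothesis.Theorems.BarrierLever.MoorePeel.windowStart (n + 1 + 1))),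
    (Summit.ValiantsHypothesis.ValiantsHypothesis.Theorems.BarrierLever.ChowBenchmarkPeel.tanMatrix P v (fun j => benchCols (n + 1) (Summit.ValiantsHypothesis.ValiantsHypothesis.Theorems.BarrierLever.MoorePeel.windowStart (n + 1 + 1)) (e j))).det ≠ 0

/-- **Node 6 (v9) — CONJECTURE HAAR** (val-np-p4 g23, p653145 `…ChowBenchmarkPairsHaar.lean`, text verbatim): for every `h`, every `n ≤ 2^h` and every injective family of
`n` rows of size ≤ 2, some point table makes the `n × n` segment-moment matrix on the FIRST `n` binary codes nonsingular (a Haar system on the code chain). STRONGER than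
`stub_segmentMeanValue` (= the instance `n = r_h`); the form that admits the one-code-at-a-time induction (`pendant_extension`). WHY IT MIGHT FAIL: a row sub-family with no
pendant ordering (cycles) identically singular on `W(n)`; exhaustive only for h ≤ 5. SOURCES: p653145; HOME/val-np-p4/g23 (num/tnc.py, flag*.py; kit j313818). -/
def Stmt.stub_haar : Prop :=
  ∀ (h n : ℕ) (S : Fin n → Finset (Fin h)), Function.Injective S → (∀ i, (S i).card ≤ 2) → n ≤ 2 ^ h →
    ∃ P : Fin h → Fin h → ℂ,
      (Matrix.of fun i j : Fin n =>
        ∑ g : (↥(benchCols h n j) → ↥(S i)), (∏ c : ↥(benchCols h n j), P (g c) c) *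
          ∏ a : ↥(S i), ((Finset.univ.filter fun c : ↥(benchCols h n j) => g c = a).card.factorial : ℂ)).det ≠ 0

/-- **Node 7 (v12) — TYPED NODE «the canonical homogeneous root has a RELAXED SPLIT CERTIFICATE (determinant leaves) at every height»** (val-np-p4 g25, p675133 `…ChowBenchmarkPairsSplitCertDetLeaf.lean`, text verbatim; v11 carried the triangular-leaf text `Stmt.splitCertCanon`, p668821, kept below as `Stmt.stub_splitCertCanon` with the arrow `stub_splitCert_of_splitCertCanon`): some levels (column permutations / one-coordinate splits with per-component vertex orders and potentials, checked by `permStep` / `splitStep`) followed by the relaxed leaf (`leafOK` or `leafOKDet` = all codes 0 + a list-coded inverse certificate mod `q`) pass `Cert.checkD`; each instance a finite search plus an `O(n³)` modular check; soundness `Cert.exists_table_of_checkD`. WEAKER than `Stmt.splitCertCanon`, STRONGER than `stub_segmentMeanValue`. WHY IT MIGHT FAIL: a height with no certificate even of this relaxed one-coordinate-split format although the determinant is nonzero (no local order rule exists: Conjecture C is false, greedy descent fails from h = 14; certificates need global look-ahead). SOURCES: p661448, p663919, p664538, p665010, p667144, p667304, p668821, p675133; kit j319385; HOME/val-np-p4/g24/MEMO-splitcert-valnp4-g24.md,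 memo g25 to follow. -/
def Stmt.stub_splitCert : Prop :=
  ∀ h : ℕ, ∃ (ls : List Summit.ValiantsHypothesis.ValiantsHypothesis.Theorems.BarrierLever.ChowBenchmarkSplit.Cert.Level) (q : ℕ) (LBt : List (List ℤ)),
    Summit.ValiantsHypothesis.ValiantsHypothesis.Theorems.BarrierLever.ChowBenchmarkSplit.Cert.checkD h (Summit.ValiantsHypothesis.ValiantsHypothesis.Theorems.BarrierLever.MoorePeel.windowStart (h + 1)) q LBt ls (Summit.ValiantsHypothesis.ValiantsHypothesis.Theorems.BarrierLever.ChowBenchmarkSplit.Cert.rootInstW (Summit.ValiantsHypothesis.ValiantsHypothesis.Theorems.BarrierLever.ChowBenchmarkSplit.Cert.hRows h) Summit.ValiantsHypothesis.ValiantsHypothesis.Theorems.BarrierLever.ChowBenchmarkSplit.Cert.hWts (Summit.ValiantsHypothesis.ValiantsHypothesis.Theorems.BarrierLever.MoorePeel.windowStart (h + 1))) = true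

/-- **Node 7, v11 text (by name, kept)** — the triangular-leaf node `ChowBenchmarkSplit.Stmt.splitCertCanon` (p668821), now a STRONGER alternative of the registered relaxed node (`stub_splitCert_of_splitCertCanon`). -/
def Stmt.stub_splitCertCanon : Prop :=
  ∀ h : ℕ, ∃ ls : List Summit.ValiantsHypothesis.ValiantsHypothesis.Theorems.BarrierLever.ChowBenchmarkSplit.Cert.Level,
    Summit.ValiantsHypothesis.ValiantsHypothesis.Theorems.BarrierLever.ChowBenchmarkSplit.Cert.check h (Summit.ValiantsHypothesis.ValiantsHypothesis.Theorems.BarrierLever.MoorePeel.windowStart (h + 1)) ls (Summit.ValiantsHypothesis.ValiantsHypothesis.Theorems.BarrierLever.ChowBenchmarkSplit.Cert.rootInstW (Summit.ValiantsHypothesis.ValiantsHypothesis.Theorems.BarrierLever.ChowBenchmarkSplit.Cert.hRows h) Summit.ValiantsHypothesis.ValiantsHypothesis.Theorems.BarrierLever.ChowBenchmarkSplit.Cert.hWts (Summit.ValiantsHypothesis.ValiantsHypothesis.Theorems.BarrierLever.MoorePeel.windowStart (h + 1))) = true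

/-! ## Registered stubs -/

/-- **Stub 1 — the certified window `h ≤ 182`.** Theorem A (`MoorePeel.mcBenchPairsAt_of_peel`, landed) + `det (peelMatrix i) ≠ 0` for
`1 ≤ i ≤ 182` (integer determinants; MEMO-g18 §3, kit j284482: exact for i ≤ 89, two 61-bit primes beyond — a `native_decide`/certificate
computation per i, or the CertA–D pattern). Why plausibly true: computed. Size L (computation-bound). Landed sub-range: h ≤ 46 (CertD). -/
theorem stub_window : Stmt.stub_window := by
  -- LANDED (val-lit-p5 g9, p590059 `Theorems/BarrierLeverChowBenchmarkPairsWindow.lean`, 2026-08-28T00:40Z): `det_peelMatrix_ne_zero_of_le_182`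
  -- (CertA–E for i ≤ 52, block-triangular kernel certificates p589673–p589677 for 53..182); statement defeq to this stub.
  exact Summit.ValiantsHypothesis.ValiantsHypothesis.Theorems.BarrierLever.MoorePeel.stub_window

/-- **Stub 2 — the transfer: segment moments ↔ the free-node benchmark minor.** Zeon-algebra units: row `S` of the minor = coefficients of
`F·∏_{a∈S}(1 + P_a·y)^{-1}`, `F` unitriangular on the down-set of binary-code columns, `(1 + P_a·y)^{-1} = Σ_A (−1)^{|A|}|A|! P_a^A y^A`,
so the two determinants differ by the unit `det F|_W = 1` and column signs. Why plausibly true: it is an identity (checked numerically in the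
memo's scripts for h ≤ 12). Size M. Leans on: `MvPolynomial.coeff_mul`, the x-private normal form (`coeff_partitionExpo_xPrivate` pattern of
…MooreBenchRows / CPM files). -/
theorem stub_dualisation : Stmt.stub_dualisation := by
  -- LANDED (prover valiant-natproofs-prover g15, p574420 `Theorems/BarrierLeverChowBenchmarkPairsDualisation.lean`, 2026-08-27T21:40Z):
  -- the Γ-reduction `det_xPrivate_eq_det_thetaHat` + `thetaHat_row_eq_sign_mul_segSum` + `Matrix.det_mul_row`; statement defeq to this stub.
  exact fun h => Summit.ValiantsHypothesis.ValiantsHypothesis.Theorems.BarrierLever.ChowBenchmarkDual.stub_dualisation h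

/-- **Stub 3 — segment mean-value unisolvence ∀h (the content).** For every `h` some configuration `P_1..P_h ∈ ℂ^h` (with `P_0 = 0`) makes
«point value at `P_0` + segment means over all pairs among `P_0..P_h`» unisolvent on the multilinear down-set space spanned by the first
`r_h = 1 + h + C(h,2)` binary codes. Why it might fail: a height at which EVERY configuration is degenerate (a dimension obstruction like the Möbius
coincidences of the one-point peel, but global) — none below 1 100 (planner certificates, Moore curve). Tool the line bets on: Hakopian /
Kergin mean-value interpolation (simplex-spline recurrence `∫_{[P,Q]} D_{Q−P} g = g(Q) − g(P)` on a D-invariant space). Size: open. -/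
theorem stub_segmentMeanValue : Stmt.stub_segmentMeanValue := by
  sorry

/-- **Stub 4 (v5) — CONJECTURE S10ℤ** (explicit integer witness; val-np-p4 g18). -/
theorem stub_s10 : Stmt.stub_s10 := by
  sorry

/-- **Stub 5 (v6) — CONJECTURE Z01** (a 0/1 design at every height; val-np-p4 g19, p626042). -/
theorem stub_zeroOneDesign : Stmt.stub_zeroOneDesign := by
  sorry

/-- **Stub 6 (v7) — CONJECTURE GTN** (generic total nonsingularity; val-np-p4 g21, p641807). -/
theorem stub_gtn : Stmt.stub_gtn := by
  sorry

/-- **Stub 7 (v8) — CONJECTURE TANGENT STEP** (the tangential collision extension; val-np-p4 g22, p647383). -/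
theorem stub_tangentStep : Stmt.stub_tangentStep := by
  sorry

/-- **Stub 8 (v9) — CONJECTURE HAAR** (the hereditary Haar-system form; val-np-p4 g23, p653145). -/
theorem stub_haar : Stmt.stub_haar := by
  sorry

/-- **Stub 9 (v12) — RELAXED SPLIT CERTIFICATES (determinant leaves) for the canonical homogeneous root** (finite search per height; val-np-p4 g25, p675133; v10/v11 texts p667304/p668821 by name). -/
theorem stub_splitCert : Stmt.stub_splitCert := by
  sorry

/-! ## Proved glue -/

/-- Moore–Chow nodes are a free-node design: `MCBenchPairsAt h → ChowBenchPairsAt h` (take `B a c = Y_a^(2^c)`). -/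
theorem chowBenchPairsAt_of_mcBenchPairsAt (h : ℕ) (hMC : MCBenchPairsAt h) : ChowBenchPairsAt h := by
  intro r u hu hcard hall
  obtain ⟨Y, hY⟩ := hMC r u hu hcard hall
  exact ⟨fun a c => Y a ^ 2 ^ (c : ℕ), by simpa only [mooreChowFactor] using hY⟩

/-- **S10ℤ ⟹ segment mean-value unisolvence at every height** (∃-introduction with the explicit table; kernel-checked). -/
theorem stub_segmentMeanValue_of_s10 : Stmt.stub_s10 → Stmt.stub_segmentMeanValue :=
  fun H h r u hu hc hs => ⟨s10Table h, H h r u hu hc hs⟩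

/-- **The item from the line** (window below 182 via the Moore–Chow certificates, transfer + mean-value unisolvence above). -/
theorem ChowBenchmarkPairs_of :
    Stmt.stub_segmentMeanValue →
      Summit.ValiantsHypothesis.ValiantsHypothesis.Theses.BarrierLever.ChowBenchmarkPairs := by
  intro hs
  have hw : Stmt.stub_window := stub_window
  have hd : Stmt.stub_dualisation := stub_dualisation
  rw [chowBenchmarkPairs_iff]
  intro h
  by_cases hh : h ≤ 182
  · exact chowBenchPairsAt_of_mcBenchPairsAt h (hw h hh)
  · exact hd h (hs h)

/-- **Composition (v5, kernel-checked): CONJECTURE S10ℤ closes the item.** -/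
theorem ChowBenchmarkPairs_of_s10 :
    Stmt.stub_s10 → Summit.ValiantsHypothesis.ValiantsHypothesis.Theses.BarrierLever.ChowBenchmarkPairs :=
  fun H => ChowBenchmarkPairs_of (stub_segmentMeanValue_of_s10 H)

/-- `Stmt.stub_zeroOneDesign` is literally p4 g19's typed Conjecture Z01 (p626042). -/
theorem stub_zeroOneDesign_iff : Stmt.stub_zeroOneDesign ↔ Summit.ValiantsHypothesis.ValiantsHypothesis.Theorems.BarrierLever.ChowBenchmarkZeroOne.Stmt.stub_zeroOneDesign := Iff.rfl

/-- **Z01 ⟹ segment mean-value unisolvence at every height** (∃-introduction with the 0/1 table; p626042's `segmentMeanValue_of_zeroOneDesign`, texts definitional). -/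
theorem stub_segmentMeanValue_of_zeroOneDesign : Stmt.stub_zeroOneDesign → Stmt.stub_segmentMeanValue :=
  fun H h r u hu hc hs => Summit.ValiantsHypothesis.ValiantsHypothesis.Theorems.BarrierLever.ChowBenchmarkZeroOne.segmentMeanValue_of_zeroOneDesign ((stub_zeroOneDesign_iff).1 H) h r u hu hc hs

/-- **Composition (v6, kernel-checked): CONJECTURE Z01 closes the item.** -/
theorem ChowBenchmarkPairs_of_zeroOneDesign :
    Stmt.stub_zeroOneDesign → Summit.ValiantsHypothesis.ValiantsHypothesis.Theses.BarrierLever.ChowBenchmarkPairs :=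
  fun H => ChowBenchmarkPairs_of (stub_segmentMeanValue_of_zeroOneDesign H)

/-- `Stmt.stub_gtn` is literally p4 g21's typed Conjecture GTN (p641807). -/
theorem stub_gtn_iff : Stmt.stub_gtn ↔ Summit.ValiantsHypothesis.ValiantsHypothesis.Theorems.BarrierLever.ChowBenchmarkGTN.Stmt.gtn := Iff.rfl

/-- **GTN ⟹ segment mean-value unisolvence at every height** (instance `T = benchCols h r`; p641807 `segmentMeanValue_of_gtn`, texts definitional). -/
theorem stub_segmentMeanValue_of_gtn : Stmt.stub_gtn → Stmt.stub_segmentMeanValue :=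
  fun H h r u hu hc hs => Summit.ValiantsHypothesis.ValiantsHypothesis.Theorems.BarrierLever.ChowBenchmarkGTN.segmentMeanValue_of_gtn ((stub_gtn_iff).1 H) h r u hu hc hs

/-- **Composition (v7, kernel-checked): CONJECTURE GTN closes the item.** -/
theorem ChowBenchmarkPairs_of_gtn :
    Stmt.stub_gtn → Summit.ValiantsHypothesis.ValiantsHypothesis.Theses.BarrierLever.ChowBenchmarkPairs :=
  fun H => ChowBenchmarkPairs_of (stub_segmentMeanValue_of_gtn H)

/-- `Stmt.stub_tangentStep` is literally p4 g22's typed Conjecture TANGENT STEP (p647383). -/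
theorem stub_tangentStep_iff : Stmt.stub_tangentStep ↔ Summit.ValiantsHypothesis.ValiantsHypothesis.Theorems.BarrierLever.ChowBenchmarkPeel.Stmt.tangentStep := Iff.rfl

/-- **TANGENT STEP ⟹ segment mean-value unisolvence at every height** (p647383 `segmentMeanValue_of_tangentStep` via `tangential_extension`; texts definitional). -/
theorem stub_segmentMeanValue_of_tangentStep : Stmt.stub_tangentStep → Stmt.stub_segmentMeanValue :=
  fun H h r u hu hc hs => Summit.ValiantsHypothesis.ValiantsHypothesis.Theorems.BarrierLever.ChowBenchmarkPeel.segmentMeanValue_of_tangentStep ((stub_tangentStep_iff).1 H) h r u hu hc hs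

/-- **Composition (v8, kernel-checked): CONJECTURE TANGENT STEP closes the item.** -/
theorem ChowBenchmarkPairs_of_tangentStep :
    Stmt.stub_tangentStep → Summit.ValiantsHypothesis.ValiantsHypothesis.Theses.BarrierLever.ChowBenchmarkPairs :=
  fun H => ChowBenchmarkPairs_of (stub_segmentMeanValue_of_tangentStep H)

/-- `Stmt.stub_haar` is literally p4 g23's typed Conjecture HAAR (p653145). -/
theorem stub_haar_iff : Stmt.stub_haar ↔ Summit.ValiantsHypothesis.ValiantsHypothesis.Theorems.BarrierLever.ChowBenchmarkHaar.Stmt.haar := Iff.rfl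

/-- **HAAR ⟹ segment mean-value unisolvence at every height** (instance `n = r`: p653145 `segmentMeanValue_of_haar`, via `r = windowStart (h+1) ≤ 2^h`; texts definitional). -/
theorem stub_segmentMeanValue_of_haar : Stmt.stub_haar → Stmt.stub_segmentMeanValue :=
  fun H h r u hu hc hs => Summit.ValiantsHypothesis.ValiantsHypothesis.Theorems.BarrierLever.ChowBenchmarkHaar.segmentMeanValue_of_haar ((stub_haar_iff).1 H) h r u hu hc hs

/-- **Composition (v9, kernel-checked): CONJECTURE HAAR closes the item.** -/
theorem ChowBenchmarkPairs_of_haar :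
    Stmt.stub_haar → Summit.ValiantsHypothesis.ValiantsHypothesis.Theses.BarrierLever.ChowBenchmarkPairs :=
  fun H => ChowBenchmarkPairs_of (stub_segmentMeanValue_of_haar H)

/-- `Stmt.stub_splitCert` is literally p4 g25's typed node `ChowBenchmarkSplit.Stmt.splitCertDet` (p675133). -/
theorem stub_splitCert_iff : Stmt.stub_splitCert ↔ Summit.ValiantsHypothesis.ValiantsHypothesis.Theorems.BarrierLever.ChowBenchmarkSplit.Stmt.splitCertDet := Iff.rfl

/-- `Stmt.stub_splitCertCanon` is literally p4 g24's typed node `ChowBenchmarkSplit.Stmt.splitCertCanon` (p668821; the v11 registered text). -/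
theorem stub_splitCertCanon_iff : Stmt.stub_splitCertCanon ↔ Summit.ValiantsHypothesis.ValiantsHypothesis.Theorems.BarrierLever.ChowBenchmarkSplit.Stmt.splitCertCanon := Iff.rfl

/-- **v11 text ⟹ v12 text** (every triangular certificate is a relaxed one: `splitCertDet_of_splitCertCanon`, p675133) — the swap is a 1:1 NARROWING, no work on the canonical node is lost. -/
theorem stub_splitCert_of_splitCertCanon : Stmt.stub_splitCertCanon → Stmt.stub_splitCert :=
  fun H => (stub_splitCert_iff).2 (Summit.ValiantsHypothesis.ValiantsHypothesis.Theorems.BarrierLever.ChowBenchmarkSplit.splitCertDet_of_splitCertCanon ((stub_splitCertCanon_iff).1 H))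

/-- **RELAXED SPLIT CERTIFICATES ⟹ segment mean-value unisolvence at every height** (p675133 `segmentMeanValue_of_splitCertDet`: soundness of the relaxed checker + `smv_of_hsmv` (translation of the origin p665010 + row-permutation transfer); texts definitional). -/
theorem stub_segmentMeanValue_of_splitCert : Stmt.stub_splitCert → Stmt.stub_segmentMeanValue :=
  fun H h r u hu hc hs => Summit.ValiantsHypothesis.ValiantsHypothesis.Theorems.BarrierLever.ChowBenchmarkSplit.segmentMeanValue_of_splitCertDet ((stub_splitCert_iff).1 H) h r u hu hc hs

/-- **Composition (v10/v11/v12, kernel-checked): the (relaxed) split-certificate node closes the item.** -/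
theorem ChowBenchmarkPairs_of_splitCert :
    Stmt.stub_splitCert → Summit.ValiantsHypothesis.ValiantsHypothesis.Theses.BarrierLever.ChowBenchmarkPairs :=
  fun H => ChowBenchmarkPairs_of (stub_segmentMeanValue_of_splitCert H)

/-- Sanity (`decide`): the supports of the first points — Σ₀ = {0}, Σ₁ = {0, 1}, Σ₂ = {0, 1, 2}, Σ₃ = {1, 2, 3}, Σ₄ = {1, 3} (codes C(m+1,2) = 0, 1, 3, 6, 10;
tops ⌊log₂ C(m+2,2)⌋ = 0, 1, 2, 3, 3). -/
example : (List.range 5).map (fun m => (List.range 5).filter fun c => s10Supp m c) = [[0], [0, 1], [0, 1, 2], [1, 2, 3], [1, 3]] := by decide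

end

end Summit.ValiantsHypothesis.ValiantsHypothesis.Cruxes.ChowBenchmarkPairs.MoorePeel
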